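import Summits.BirchSwinnertonDyer.BirchSwinnertonDyer.Theorems.CMKolyvaginAtInertTwoCMKolyvaginConjectureAtInertTwoPositiveDepthDatumFree
import Summits.BirchSwinnertonDyer.BirchSwinnertonDyer.Theorems.CMKolyvaginAtInertTwoCMKolyvaginConjectureAtInertTwoPositiveDepthGenusTrace
import HarnessLib

/-!
# Crux `CMKolyvaginConjectureAtInertTwo` (stmt-BirchSwinnertonDyer-24648), open stub `stub_positiveDepth`:
# AT A SHALLOW CM-INERT KOLYVAGIN PRIME (`ℓ ≡ 1 (mod 4)`) THE WITNESS DESCENDS TO THE GENUS QUADRATIC LAYER —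
# `P(ℓ) ∈ 2E(K[ℓ]) ⟺` the genus point is `2`-divisible among the `⟨σ_ℓ²⟩`-FIXED, `σ_ℓ`-ANTI-INVARIANT points

Route `CMKolyvaginAtInertTwo` (cell `pub/bsd-eis`, seat `leafhand-bsd-cmkolyvaginatinert-2` g0); helper (`--supports
stmt-BirchSwinnertonDyer-24648 --as helper`). THEOREMS ONLY (no definition, no named fact, no `sorry`); closes nothing;
BSD is proved for no curve. Sequel of p794939 (`two_dvd_derivedPoint_iff_two_dvd_halfTrace`) and of this seat's #2
(`…DeepDivisibleOfBSDTwo`: granted BSD₂(E), on `Σ ≥ 2` frames the crux's witness must have a SHALLOW prime factor).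

WHAT. At a CM-inert Zhang–Kolyvagin prime `ℓ` at `2` (so `a_ℓ = 0` and `M(ℓ) = v₂(ℓ+1)`), write `G_ℓ = ⟨σ⟩` (order `ℓ + 1`),
`H_ℓ = ⟨σ²⟩` (order `m = (ℓ+1)/2`), `A = Σ_{k<m} σ^{2k} y(ℓ)` (the `H_ℓ`-norm of `y(ℓ)`, p794939's half-trace, `σA = −A`) and
`g = Σ_{s∈S} s(A)` (the GENUS POINT). p794939: `P(ℓ) ∈ 2E(K[ℓ]) ⟺ g ∈ 2E(K[ℓ])`. The prime is SHALLOW when `M(ℓ) = 1`, i.e.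
`ℓ ≡ 1 (mod 4)`, i.e. `m = |H_ℓ|` is ODD. Then:

* §1 (algebra) `map_sum_range_pow_eq_self` — `τ (Σ_{k<m} τ^k x) = Σ_{k<m} τ^k x` when `τ^m = 1`;
  `two_dvd_iff_two_dvd_fixed_of_odd` — for `τ` of ODD exponent `m` (`τ^m = 1`) and a `τ`-fixed `z`:
  `z ∈ 2A ⟺ z ∈ 2·A^{τ}` (average a square root over `⟨τ⟩`: `Q' = Σ_k τ^k Q − ((m−1)/2)·z`).
* §2 `pointGalHom_σ_sq_genusPoint` — `σ² g = g` (ANY CM-inert Kolyvagin prime; `𝒢_ℓ` abelian, `σ^{ℓ+1} = 1`);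
  `pointGalHom_σ_genusPoint_eq_neg` — `σ g = −g`;
  **`two_dvd_derivedPoint_iff_exists_fixed_of_shallow`** — for `ℓ ≡ 1 (mod 4)`:
  `P(ℓ) ∈ 2E(K[ℓ]) ⟺ ∃ Q, σ²Q = Q ∧ 2Q = g` — the witness lives among the `H_ℓ`-fixed points, i.e. (Galois descent, not
  needed here) in `E(L_ℓ)` for the GENUS QUADRATIC LAYER `L_ℓ = K[ℓ]^{H_ℓ} ⊇ K[1]`, `[L_ℓ : K[1]] = 2` (for `ℓ ≡ 1 (mod 4)`,
  `L_ℓ = K[1](√ℓ)` by genus theory of the order of conductor `ℓ`);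
  **`two_dvd_derivedPoint_iff_exists_anti_of_shallow`** — on H₂ (`2` inert in `F`, `ρ̄_{E,2}` onto, so `E(K[ℓ])[2] = 0`,
  p794939 `twoTorsion_eq_zero_of_cmInert_prime`): `P(ℓ) ∈ 2E(K[ℓ]) ⟺ ∃ Q, σ²Q = Q ∧ σQ = −Q ∧ 2Q = g` — the witness is a
  point of the `σ`-ANTI-invariant part `E(L_ℓ)^−`, i.e. of the quadratic twist of `E` by the genus character of `L_ℓ/K[1]`
  over `K[1]`. So the SHALLOW part of Kolyvagin's conjecture at `2` on H₂ is a level-ONE `2`-indivisibility statement for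
  genus/twisted Heegner points (Birch–genus territory: Tian, Kriz–Li, Coates–Li–Tian–Zhai), not an `M ≥ 2` descent statement.
  For DEEP primes (`m` even) the averaging trick is unavailable and no such descent is claimed.

HONEST FRAMING: elementary group bookkeeping over tree theorems; the twist identification `E(L_ℓ)^− ≃ E^{(χ_ℓ)}(K[1])` and any
non-vanishing are NOT formalised here; no stub is closed; BSD is proved for no curve.
[cite: GrossLMS1991, §3 (3.5), §4 (4.1)] [cite: WZhang2014, §3.7 (M(ℓ))] [cite: Cox2013, §7.D, §9.A (genus theory of orders)]
-/

set_option linter.dupNamespace false -- `Summit.BirchSwinnertonDyer.BirchSwinnertonDyer.Theorems.…` (summit = sub)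
set_option autoImplicit false

noncomputable section

open scoped Classical

namespace Summit.BirchSwinnertonDyer.BirchSwinnertonDyer.Theorems.CMKolyvaginConjecturePositiveDepth

open Finset

/-! ## §1 Algebra: averaging over a cyclic group of odd order -/

section Algebra

variable {G : Type*} [Group G] {A : Type*} [AddCommGroup A] (ρ : G →* AddMonoid.End A)

/-- `τ^k z = z` when `τ z = z`. [folklore] -/
theorem map_pow_eq_self_of_map_eq_self (τ : G) (z : A) (hz : ρ τ z = z) (k : ℕ) : ρ (τ ^ k) z = z := by
  induction k with
  | zero => rw [pow_zero, map_one]; rfl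
  | succ k ih =>
    rw [pow_succ', map_mul]
    change ρ τ (ρ (τ ^ k) z) = z
    rw [ih, hz]

/-- **The `⟨τ⟩`-norm is `τ`-invariant**: `τ (Σ_{k<m} τ^k x) = Σ_{k<m} τ^k x` when `τ^m = 1` (a cyclic shift of the sum).
[folklore] -/
theorem map_sum_range_pow_eq_self (τ : G) (m : ℕ) (hτ : τ ^ m = 1) (x : A) :
    ρ τ (∑ k ∈ range m, ρ (τ ^ k) x) = ∑ k ∈ range m, ρ (τ ^ k) x := by
  have hstep : ∀ k : ℕ, ρ τ (ρ (τ ^ k) x) = ρ (τ ^ (k + 1)) x := fun k ↦ by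
    rw [pow_succ', map_mul]; rfl
  rw [map_sum]
  simp only [hstep]
  have hf : ρ (τ ^ m) x = ρ (τ ^ 0) x := by rw [hτ, pow_zero]
  have key : ∑ k ∈ range m, ρ (τ ^ (k + 1)) x + ρ (τ ^ 0) x = ∑ k ∈ range m, ρ (τ ^ k) x + ρ (τ ^ 0) x := by
    rw [← Finset.sum_range_succ' (fun k ↦ ρ (τ ^ k) x), Finset.sum_range_succ, hf]
  exact add_right_cancel key

/-- **Averaging over a cyclic group of ODD order**: if `τ^m = 1` with `m` odd and `τ z = z`, then
`z ∈ 2A ⟺ z = 2Q` for some `τ`-FIXED `Q` (take `Q' = Σ_{k<m} τ^k Q − ((m−1)/2)·z`: `2Q' = m·z − (m−1)·z = z`). [folklore] -/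
theorem two_dvd_iff_two_dvd_fixed_of_odd (τ : G) (m : ℕ) (hm : Odd m) (hτ : τ ^ m = 1) (z : A) (hz : ρ τ z = z) :
    (∃ Q : A, (2 : ℤ) • Q = z) ↔ ∃ Q : A, ρ τ Q = Q ∧ (2 : ℤ) • Q = z := by
  refine ⟨fun ⟨Q, hQ⟩ ↦ ?_, fun ⟨Q, _, hQ⟩ ↦ ⟨Q, hQ⟩⟩
  obtain ⟨r, hr⟩ := hm
  -- the `⟨τ⟩`-average of `Q`
  set N : A := ∑ k ∈ range m, ρ (τ ^ k) Q with hN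
  have hNfix : ρ τ N = N := map_sum_range_pow_eq_self ρ τ m hτ Q
  have h2N : (2 : ℤ) • N = (m : ℤ) • z := by
    rw [hN, Finset.smul_sum]
    simp only [← map_zsmul, hQ, map_pow_eq_self_of_map_eq_self ρ τ z hz]
    rw [Finset.sum_const, Finset.card_range, natCast_zsmul]
  refine ⟨N - (r : ℤ) • z, ?_, ?_⟩
  · rw [map_sub, map_zsmul, hNfix, hz]
  · rw [smul_sub, h2N, smul_smul, ← sub_smul]
    have h1 : (m : ℤ) - 2 * r = 1 := by omega
    rw [h1, one_smul]

end Algebra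

/-! ## §2 The genus point at a CM-inert Kolyvagin prime; descent at SHALLOW primes -/

section Heegner

open WeierstrassCurve NumberField Literature.NumberTheory.EllipticCurves
  Literature.NumberTheory.EllipticCurves.ModularForms Literature.NumberTheory.EllipticCurves.Rank1Residual
  Summit.BirchSwinnertonDyer.BirchSwinnertonDyer.Theorems

variable {K : Type} [Field K] [NumberField K]

/-- `σ_ℓ^{ℓ+1} = 1` for the generator of a prime-conductor datum (`orderOf σ_ℓ = ℓ + 1`, p794939), hence
`(σ_ℓ²)^{(ℓ+1)/2} = 1` for odd `ℓ`. [cite: GrossLMS1991, §3 (G_ℓ cyclic of order ℓ+1)] -/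
theorem σ_sq_pow_half_eq_one (W : WeierstrassCurve ℚ) {N : ℕ} [NeZero N]
    (hK : IsImaginaryQuadratic K) (hodd : Odd (NumberField.discr K)) (h3 : NumberField.discr K ≠ -3)
    {Dt : ModularParametrizationData W N} {β : ℤ} {ι : K →+* ℂ} {ℓ : ℕ} (hℓ : ℓ.Prime) (hℓodd : Odd ℓ)
    (hinert : (Ideal.span {(ℓ : 𝓞 K)}).IsPrime) (d : KolyvaginHeegnerData Dt β ι ℓ) :
    (d.σ ℓ ^ 2) ^ ((ℓ + 1) / 2) = 1 := by
  have h2 : 2 * ((ℓ + 1) / 2) = ℓ + 1 := by obtain ⟨r, hr⟩ := hℓodd; omega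
  rw [← pow_mul, h2, ← orderOf_σ_eq_succ_of_prime W hK hodd h3 hℓ hinert d]
  exact pow_orderOf_eq_one _

/-- **`σ_ℓ²` fixes the genus point** `g = Σ_{s∈S} s(Σ_{k<(ℓ+1)/2} σ_ℓ^{2k} y(ℓ))` at ANY prime `ℓ` inert in `K` (odd `ℓ`,
odd `d_K ≠ −3`): `𝒢_ℓ = Gal(K[ℓ]/K)` is abelian (tree `commute_of_mem_ringClassGal`) and the inner sum is the norm along
`H_ℓ = ⟨σ_ℓ²⟩`, `(σ_ℓ²)^{(ℓ+1)/2} = 1`. [cite: GrossLMS1991, §3 (𝒢_n abelian), §4 (4.1)] [cite: Cox2013, §9.A] -/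
theorem pointGalHom_σ_sq_genusPoint (W : WeierstrassCurve ℚ) {N : ℕ} [NeZero N]
    (hK : IsImaginaryQuadratic K) (hodd : Odd (NumberField.discr K)) (h3 : NumberField.discr K ≠ -3)
    {Dt : ModularParametrizationData W N} {β : ℤ} {ι : K →+* ℂ} {ℓ : ℕ} (hℓ : ℓ.Prime) (hℓodd : Odd ℓ)
    (hinert : (Ideal.span {(ℓ : 𝓞 K)}).IsPrime) (d : KolyvaginHeegnerData Dt β ι ℓ) :
    pointGalHom W (ringClassField K ι ℓ) (d.σ ℓ ^ 2)
        (∑ s ∈ d.S, pointGalHom W (ringClassField K ι ℓ) s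
          (∑ k ∈ range ((ℓ + 1) / 2), pointGalHom W (ringClassField K ι ℓ) ((d.σ ℓ ^ 2) ^ k) d.y)) =
      ∑ s ∈ d.S, pointGalHom W (ringClassField K ι ℓ) s
        (∑ k ∈ range ((ℓ + 1) / 2), pointGalHom W (ringClassField K ι ℓ) ((d.σ ℓ ^ 2) ^ k) d.y) := by
  have hℓℓ : ℓ ∈ ℓ.primeFactors := Nat.mem_primeFactors.mpr ⟨hℓ, dvd_rfl, hℓ.ne_zero⟩
  have hσG : d.σ ℓ ∈ ringClassGal ι ℓ :=
    ringClassGalOver_le_ringClassGal ι ℓ (ℓ / ℓ) (by rw [← d.zpowers_σ ℓ hℓℓ]; exact Subgroup.mem_zpowers _)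
  have hσ2G : d.σ ℓ ^ 2 ∈ ringClassGal ι ℓ := Subgroup.pow_mem _ hσG 2
  rw [map_sum]
  refine Finset.sum_congr rfl fun s hs ↦ ?_
  have hc : d.σ ℓ ^ 2 * s = s * d.σ ℓ ^ 2 := commute_of_mem_ringClassGal hK hℓ.ne_zero hσ2G (d.S_subset s hs)
  have h' := congrArg (fun g ↦ pointGalHom W (ringClassField K ι ℓ) g
    (∑ k ∈ range ((ℓ + 1) / 2), pointGalHom W (ringClassField K ι ℓ) ((d.σ ℓ ^ 2) ^ k) d.y)) hc
  simp only [map_mul] at h'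
  refine h'.trans ?_
  change pointGalHom W (ringClassField K ι ℓ) s (pointGalHom W (ringClassField K ι ℓ) (d.σ ℓ ^ 2)
    (∑ k ∈ range ((ℓ + 1) / 2), pointGalHom W (ringClassField K ι ℓ) ((d.σ ℓ ^ 2) ^ k) d.y)) = _
  rw [map_sum_range_pow_eq_self (pointGalHom W (ringClassField K ι ℓ)) (d.σ ℓ ^ 2) ((ℓ + 1) / 2)
    (σ_sq_pow_half_eq_one W hK hodd h3 hℓ hℓodd hinert d) d.y]

/-- **`σ_ℓ` acts by `−1` on the genus point** at a CM-inert Zhang–Kolyvagin prime at `2` (frame: `W/ℚ` globally minimal with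
CM, `K` imaginary quadratic with odd `d_K ≠ −3`, Heegner for `N_E`): `σ_ℓ g = −g` (p794939's `σ_ℓ A = −A` for the half-trace
`A`, and `𝒢_ℓ` abelian). [cite: GrossLMS1991, §3 Prop. 3.7 (1), §4 (4.1)] -/
theorem pointGalHom_σ_genusPoint_eq_neg (W : WeierstrassCurve ℚ) [W.IsElliptic] [W.IsGloballyMinimal]
    [NeZero (W.conductorNorm ℤ)] (hCM : W.HasCM) (hK : IsImaginaryQuadratic K)
    (hodd : Odd (NumberField.discr K)) (h3 : NumberField.discr K ≠ -3)
    (hH : SatisfiesHeegnerHypothesis (W.conductorNorm ℤ) K)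
    {Dt : ModularParametrizationData W (W.conductorNorm ℤ)} {β : ℤ} {ι : K →+* ℂ} {ℓ : ℕ}
    (hℓK : Zhang2014.IsKolyvaginPrime (W.conductorNorm ℤ) W K 2 ℓ) (hℓF : CMInert W ℓ)
    (d : KolyvaginHeegnerData Dt β ι ℓ) :
    pointGalHom W (ringClassField K ι ℓ) (d.σ ℓ)
        (∑ s ∈ d.S, pointGalHom W (ringClassField K ι ℓ) s
          (∑ k ∈ range ((ℓ + 1) / 2), pointGalHom W (ringClassField K ι ℓ) ((d.σ ℓ ^ 2) ^ k) d.y)) =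
      -∑ s ∈ d.S, pointGalHom W (ringClassField K ι ℓ) s
        (∑ k ∈ range ((ℓ + 1) / 2), pointGalHom W (ringClassField K ι ℓ) ((d.σ ℓ ^ 2) ^ k) d.y) := by
  have hℓ := hℓK.1
  have hℓℓ : ℓ ∈ ℓ.primeFactors := Nat.mem_primeFactors.mpr ⟨hℓ, dvd_rfl, hℓ.ne_zero⟩
  have hσG : d.σ ℓ ∈ ringClassGal ι ℓ :=
    ringClassGalOver_le_ringClassGal ι ℓ (ℓ / ℓ) (by rw [← d.zpowers_σ ℓ hℓℓ]; exact Subgroup.mem_zpowers _)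
  have hA := pointGalHom_σ_halfTrace_eq_neg W hCM hK hodd h3 hH hℓK hℓF d
  rw [map_sum, ← Finset.sum_neg_distrib]
  refine Finset.sum_congr rfl fun s hs ↦ ?_
  have hc : d.σ ℓ * s = s * d.σ ℓ := commute_of_mem_ringClassGal hK hℓ.ne_zero hσG (d.S_subset s hs)
  have h' := congrArg (fun g ↦ pointGalHom W (ringClassField K ι ℓ) g
    (∑ k ∈ range ((ℓ + 1) / 2), pointGalHom W (ringClassField K ι ℓ) ((d.σ ℓ ^ 2) ^ k) d.y)) hc
  simp only [map_mul] at h'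
  refine h'.trans ?_
  change pointGalHom W (ringClassField K ι ℓ) s (pointGalHom W (ringClassField K ι ℓ) (d.σ ℓ)
    (∑ k ∈ range ((ℓ + 1) / 2), pointGalHom W (ringClassField K ι ℓ) ((d.σ ℓ ^ 2) ^ k) d.y)) = _
  rw [hA, map_neg]

/-- **SHALLOW GENUS DESCENT.** Frame: `W/ℚ` globally minimal with CM, `K` imaginary quadratic with odd `d_K ≠ −3` and Heegner
for `N_E`, `ℓ` a Zhang–Kolyvagin prime at `2` inert in `F` which is SHALLOW: `ℓ ≡ 1 (mod 4)` (`M(ℓ) = v₂(ℓ+1) = 1`, as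
`a_ℓ = 0`), any datum `d` of conductor `ℓ`. Then, with `g = Σ_{s∈S} s(Σ_{k<(ℓ+1)/2} σ_ℓ^{2k} y(ℓ))` the genus point:
**`P(ℓ) ∈ 2E(K[ℓ]) ⟺ ∃ Q, σ_ℓ² Q = Q ∧ 2Q = g`** — a square root of `g` may be taken among the `H_ℓ = ⟨σ_ℓ²⟩`-fixed points
(= `E(L_ℓ)`, `L_ℓ` the genus quadratic layer of `K[ℓ]/K[1]`), because `|H_ℓ| = (ℓ+1)/2` is ODD (p794939
`two_dvd_derivedPoint_iff_two_dvd_halfTrace` + `two_dvd_iff_two_dvd_fixed_of_odd`). [cite: GrossLMS1991, §3 (3.5), §4 (4.1)]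
[cite: WZhang2014, §3.7 (M(ℓ))] [cite: Cox2013, §9.A] -/
theorem two_dvd_derivedPoint_iff_exists_fixed_of_shallow (W : WeierstrassCurve ℚ) [W.IsElliptic]
    [W.IsGloballyMinimal] [NeZero (W.conductorNorm ℤ)] (hCM : W.HasCM) (hK : IsImaginaryQuadratic K)
    (hodd : Odd (NumberField.discr K)) (h3 : NumberField.discr K ≠ -3)
    (hH : SatisfiesHeegnerHypothesis (W.conductorNorm ℤ) K)
    {Dt : ModularParametrizationData W (W.conductorNorm ℤ)} {β : ℤ} {ι : K →+* ℂ} {ℓ : ℕ}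
    (hℓK : Zhang2014.IsKolyvaginPrime (W.conductorNorm ℤ) W K 2 ℓ) (hℓF : CMInert W ℓ) (hℓ4 : ℓ % 4 = 1)
    (d : KolyvaginHeegnerData Dt β ι ℓ) :
    (∃ Q : (W.baseChange (ringClassField K ι ℓ)).toAffine.Point, (2 : ℤ) • Q = d.derivedPoint) ↔
      ∃ Q : (W.baseChange (ringClassField K ι ℓ)).toAffine.Point,
        pointGalHom W (ringClassField K ι ℓ) (d.σ ℓ ^ 2) Q = Q ∧ (2 : ℤ) • Q =
          ∑ s ∈ d.S, pointGalHom W (ringClassField K ι ℓ) s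
            (∑ k ∈ range ((ℓ + 1) / 2), pointGalHom W (ringClassField K ι ℓ) ((d.σ ℓ ^ 2) ^ k) d.y) := by
  have hℓ := hℓK.1
  have hinert : (Ideal.span {(ℓ : 𝓞 K)}).IsPrime := hℓK.2.2.2.2.1
  have hℓodd : Odd ℓ := hℓ.odd_of_ne_two hℓK.2.2.2.1
  have hmodd : Odd ((ℓ + 1) / 2) := by
    rw [Nat.odd_iff]
    omega
  rw [two_dvd_derivedPoint_iff_two_dvd_halfTrace W hCM hK hodd h3 hH hℓK hℓF d]
  exact two_dvd_iff_two_dvd_fixed_of_odd (pointGalHom W (ringClassField K ι ℓ)) (d.σ ℓ ^ 2) ((ℓ + 1) / 2) hmodd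
    (σ_sq_pow_half_eq_one W hK hodd h3 hℓ hℓodd hinert d) _
    (pointGalHom_σ_sq_genusPoint W hK hodd h3 hℓ hℓodd hinert d)

/-- **SHALLOW GENUS DESCENT ON H₂, anti-invariant form.** Same frame with moreover `2` inert in `F` and `ρ̄_{E,2}` onto (so
`E(K[ℓ])[2] = 0`, p794939 `twoTorsion_eq_zero_of_cmInert_prime`), `ℓ ≡ 1 (mod 4)` a CM-inert Zhang–Kolyvagin prime at `2`:
**`P(ℓ) ∈ 2E(K[ℓ]) ⟺ ∃ Q, σ_ℓ² Q = Q ∧ σ_ℓ Q = −Q ∧ 2Q = g`** — the square root of the genus point is `H_ℓ`-fixed AND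
`σ_ℓ`-anti-invariant, i.e. a point of `E(L_ℓ)^−` (the quadratic twist of `E` by the genus character of `L_ℓ/K[1]`, over
`K[1]`): from `σ_ℓ²Q = Q`, `2Q = g` and `σ_ℓ g = −g` the point `σ_ℓ Q + Q` is `2`-torsion, hence `0`. The SHALLOW part of
Kolyvagin's conjecture at `2` on H₂ is thus a level-one `2`-indivisibility statement in a genus-twist family.
[cite: GrossLMS1991, §3 (3.5), Prop. 3.7 (1), §4 (4.1)] [cite: WZhang2014, §3.7 (M(ℓ))] [cite: Cox2013, §9.A] -/
theorem two_dvd_derivedPoint_iff_exists_anti_of_shallow (W : WeierstrassCurve ℚ) [W.IsElliptic]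
    [W.IsGloballyMinimal] [NeZero (W.conductorNorm ℤ)] (hCM : W.HasCM) (hin : CMInert W 2)
    (hρ : W.HasSurjectiveModNGaloisRep (2 : ℤ)) (hK : IsImaginaryQuadratic K)
    (hodd : Odd (NumberField.discr K)) (h3 : NumberField.discr K ≠ -3)
    (hH : SatisfiesHeegnerHypothesis (W.conductorNorm ℤ) K)
    {Dt : ModularParametrizationData W (W.conductorNorm ℤ)} {β : ℤ} {ι : K →+* ℂ} {ℓ : ℕ}
    (hℓK : Zhang2014.IsKolyvaginPrime (W.conductorNorm ℤ) W K 2 ℓ) (hℓF : CMInert W ℓ) (hℓ4 : ℓ % 4 = 1)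
    (d : KolyvaginHeegnerData Dt β ι ℓ) :
    (∃ Q : (W.baseChange (ringClassField K ι ℓ)).toAffine.Point, (2 : ℤ) • Q = d.derivedPoint) ↔
      ∃ Q : (W.baseChange (ringClassField K ι ℓ)).toAffine.Point,
        pointGalHom W (ringClassField K ι ℓ) (d.σ ℓ ^ 2) Q = Q ∧
        pointGalHom W (ringClassField K ι ℓ) (d.σ ℓ) Q = -Q ∧ (2 : ℤ) • Q =
          ∑ s ∈ d.S, pointGalHom W (ringClassField K ι ℓ) s
            (∑ k ∈ range ((ℓ + 1) / 2), pointGalHom W (ringClassField K ι ℓ) ((d.σ ℓ ^ 2) ^ k) d.y) := by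
  rw [two_dvd_derivedPoint_iff_exists_fixed_of_shallow W hCM hK hodd h3 hH hℓK hℓF hℓ4 d]
  refine ⟨fun ⟨Q, hfix, hQ⟩ ↦ ⟨Q, hfix, ?_, hQ⟩, fun ⟨Q, hfix, _, hQ⟩ ↦ ⟨Q, hfix, hQ⟩⟩
  have hg := pointGalHom_σ_genusPoint_eq_neg W hCM hK hodd h3 hH hℓK hℓF d
  -- `σQ + Q` is `2`-torsion: `2(σQ + Q) = σ g + g = 0`
  have h2 : (2 : ℤ) • (pointGalHom W (ringClassField K ι ℓ) (d.σ ℓ) Q + Q) = 0 := by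
    rw [smul_add, ← map_zsmul, hQ, hg, neg_add_cancel]
  have h0 := twoTorsion_eq_zero_of_cmInert_prime W hCM hin hρ hK ι hH hℓK.1 hℓF _ h2
  exact eq_neg_of_add_eq_zero_left h0

end Heegner

end Summit.BirchSwinnertonDyer.BirchSwinnertonDyer.Theorems.CMKolyvaginConjecturePositiveDepth

end
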